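import Summits.CriticalPhenomena.PercolationContinuityZ3.Theorems.PercNearOneGluingAdditiveGluingAL5RestrictedLemma3
import Literature.Probability.Percolation.KozmaNitzanPreFKG
import Literature.Probability.Percolation.KozmaNitzanGoodQuadruple
import HarnessLib

/-!
# Kozma–Nitzan's Question 9 holds for two relays, and the star decomposition that reduces it to glued sets

Helper for crux `PercNearOneGluingNoHeavy.NoHeavyLowerTail` (item stmt-CriticalPhenomena-4575, closed), lemma factory
prim-lf-2 (deletion–contraction), gen 13.  No definitions, no named facts, no sorries; standard axioms.

Kozma–Nitzan (arXiv:2401.12397, §5.5 p. 36), QUESTION 9: "Let `H` be the graph given from `G` by removing all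
edges going out of `0`.  Let `a` be the point minimising `P_H(a ↔ b)` among the points of `A`.  Is it true that in
this case (41) `P(0 ↔ b, 0 ↔ A) ≥ P(0 ↔ A, a ↔ b)` holds?"  (The tree's `SoloBlindKN.knQuestion7_of_question9`
shows Question 9 ⟹ Question 7 and `…KnQuestion9Shortening` Question 9 ⟹ Conjecture 6; Question 7 is a theorem for
every `|A|`, `Q7Psi.kn_question7`.)

* `KnQ9.glued_pair_le` — **the glued-set comparison for two relays** (any finite weighted graph, any vertex set
  `N`): if `μ(z ↔ b) ≤ μ(x ↔ b)` then
  `μ(({z↔b} ∪ ({z↔N} ∩ {N↔b})) ∩ ({N↔x} ∪ {N↔z})) ≤ μ({N↔b} ∩ ({N↔x} ∪ {N↔z}))`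
  (`N ↔ v` := some vertex of `N` is joined to `v`), i.e. the pre-FKG inequality (41) at the vertex `[N]` of the
  graph with `N` glued to a point, relays `{x, z}`, for the relay `z` designated BEFORE the gluing.  Proof: on
  `{z ↔ N}` both events are `{z↔N} ∩ {N↔b}`; on `M = {z ↮ N}` Kozma–Nitzan's Lemma 3(i) for the pair `(x, z)`
  with the increasing event `{z ↔ N}` of `C_z` and slack `μ(x↔b) − μ(z↔b)` gives the RESTRICTED comparison
  `μ(M ∩ {z↔b}) ≤ μ(M ∩ {x↔b})`, and the tree's restricted Lemma 3(i) (`knLemma3i_restricted`, BHK given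
  `{C_z ∩ N = ∅}`) with the increasing event `{N ↔ x}` of `C_x` gives `μ(M ∩ {z↔b} ∩ {N↔x}) ≤ μ(M ∩ {x↔b} ∩ {N↔x})
  ≤ μ(M ∩ {N↔b} ∩ {N↔x})`.
* `KnQ9.star_le` / `KnQ9.block41_of_stars` — **the star decomposition** (the mechanism of Kozma–Nitzan's Lemma 5
  and Theorem 4, pp. 13–14): under the star event `σ_B` ("the open pairs at `0` are exactly those to `B`") an open
  path through `0` enters and leaves through `B` (`KNPreFKG.walk_decomp`), and `σ_B` is independent of the pairs off
  `0` (`KNGoodAux.real_starEvent_inter_of_determinedBy`); so (41) at `0` for a relay `z` and a relay set `A` follows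
  from the glued-set inequalities
  `μ_H(({z↔b} ∪ ({z↔B} ∩ {B↔b})) ∩ {B↔A}) ≤ μ_H({B↔b} ∩ {B↔A})` for every `B ∌ 0`, `H = G ∖ E(0)`
  (`restrW {0}ᶜ w`).  This is the socket through which a glued-set theorem for `k` relays gives Question 9 for
  `|A| = k`; note that the restriction to `{z ↮ B}` implicit in the left event is essential — the unrestricted
  set-observer inequality `μ_H({z↔b} ∩ {B↔A}) ≤ μ_H({B↔b} ∩ {B↔A})` is strictly weaker (exact examples in the
  seat memo prim-lf-2/Q9-STAR-gen13.md).
* `KnQ9.knQuestion9_two` — **QUESTION 9 ANSWERED FOR TWO RELAYS**: for `x, z ≠ 0` with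
  `μ_H(z ↔ b) ≤ μ_H(x ↔ b)`, `H = restrW {0}ᶜ w`:  `μ({z↔b} ∩ {0↔{x,z}}) ≤ μ({0↔b} ∩ {0↔{x,z}})` on every finite
  weighted graph; `KnQ9.knQuestion9_of_card_le_two` — the same for every relay set `A` with `|A| ≤ 2` in the
  shape of the hypothesis of `SoloBlindKN.knQuestion7_of_question9`.
Printed status: Theorem 4 (p. 12) is the case where `0` is joined only to `A`; Theorem 5 (p. 13) allows one further
neighbour under a goodness hypothesis; Question 9 for `|A| = 2` with arbitrary neighbourhoods of `0` is not in the
paper.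
[cite: KozmaNitzan2024, Question 9 (§5.5 p. 36); Lemma 3(i) (pp. 6–7); Lemma 5, Theorems 4–5 (pp. 12–14)]
[cite: VandenbergHaggstromKahn2005, Thms. 1.3–1.5 (pp. 6–8)]
-/

noncomputable section

namespace Summit.CriticalPhenomena.PercolationContinuityZ3.Theorems

open MeasureTheory Set
open Literature.Probability.LatticeModels (prodBernoulli)
open Literature.Probability.Percolation
open scoped Classical

namespace KnQ9

variable {V : Type*} [Fintype V]

/-! ### The glued-set comparison for two relays -/

omit [Fintype V] in
/-- `N ↔ x` is an increasing event of the open edge cluster of `x`. [folklore] -/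
theorem setConn_mono_openEdgeCluster (N : Set V) (x : V) (ω ω' : BondConfig V)
    (hω : ω ∈ {ω : BondConfig V | ∃ u ∈ N, (openGraph ω).Reachable u x})
    (hsub : openEdgeCluster ω x ⊆ openEdgeCluster ω' x) :
    ω' ∈ {ω : BondConfig V | ∃ u ∈ N, (openGraph ω).Reachable u x} := by
  obtain ⟨u, huN, hux⟩ := hω
  refine ⟨u, huN, ?_⟩
  have h := (reachable_iff_exists_mem_openEdgeCluster ω x u).1 hux.symm
  refine ((reachable_iff_exists_mem_openEdgeCluster ω' x u).2 ?_).symm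
  exact h.imp id fun ⟨e, he, hue⟩ => ⟨e, hsub he, hue⟩

/-- **Restricted comparison from an unrestricted one** (Kozma–Nitzan Lemma 3(i) with slack, read backwards): if
`μ(z ↔ b) ≤ μ(x ↔ b)` then `μ({z ↮ N} ∩ {z ↔ b}) ≤ μ({z ↮ N} ∩ {x ↔ b})` for every vertex set `N` — on the
increasing event `{z ↔ N}` of `C_z` the vertex `x` can beat `z` by at most the slack `μ(x↔b) − μ(z↔b)`.
[cite: KozmaNitzan2024, Lemma 3(i) (pp. 6–7)] -/
theorem restricted_le_of_le (w : Sym2 V → unitInterval) (x z b : V) (N : Set V)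
    (h : (prodBernoulli w).real (openConn z b) ≤ (prodBernoulli w).real (openConn x b)) :
    (prodBernoulli w).real ({ω : BondConfig V | ∀ u ∈ N, ¬ (openGraph ω).Reachable z u} ∩ openConn z b) ≤
      (prodBernoulli w).real ({ω : BondConfig V | ∀ u ∈ N, ¬ (openGraph ω).Reachable z u} ∩ openConn x b) := by
  set μ := prodBernoulli w with hμ
  set M : Set (BondConfig V) := {ω | ∀ u ∈ N, ¬ (openGraph ω).Reachable z u} with hM
  set δ : ℝ := μ.real (openConn x b) - μ.real (openConn z b) with hδ
  have hδ0 : 0 ≤ δ := by rw [hδ]; linarith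
  -- the upper family `𝒬` of edge sets whose edges (or `z` itself) meet `N`: `{C_z ∈ 𝒬} = {z ↔ N} = Mᶜ`
  set 𝒬 : Set (Set (Sym2 V)) := {C | ∃ u ∈ N, u = z ∨ ∃ e ∈ C, u ∈ e} with h𝒬
  have h𝒬up : IsUpperSet 𝒬 := by
    intro C C' hCC' hC
    obtain ⟨u, huN, hu⟩ := hC
    exact ⟨u, huN, hu.imp id fun ⟨e, he, hue⟩ => ⟨e, hCC' he, hue⟩⟩
  have hQ : {ω : BondConfig V | openEdgeCluster ω z ∈ 𝒬} = Mᶜ := by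
    ext ω
    simp only [h𝒬, hM, mem_setOf_eq, mem_compl_iff, not_forall, not_not]
    constructor
    · rintro ⟨u, huN, hu⟩
      exact ⟨u, huN, (reachable_iff_exists_mem_openEdgeCluster ω z u).2 hu⟩
    · rintro ⟨u, huN, hu⟩
      exact ⟨u, huN, (reachable_iff_exists_mem_openEdgeCluster ω z u).1 hu⟩
  have L3 := KozmaNitzan2024_lemma3_i w x z b hδ0 (by rw [hδ]; linarith) h𝒬up
  rw [hQ] at L3
  have hsplit : ∀ A : Set (BondConfig V), μ.real A = μ.real (M ∩ A) + μ.real (A ∩ Mᶜ) := by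
    intro A
    rw [inter_comm M A, ← measureReal_inter_add_sdiff (s := A) (MeasurableSet.of_discrete : MeasurableSet M),
      Set.sdiff_eq]
  have hx := hsplit (openConn x b)
  have hz := hsplit (openConn z b)
  have hle1 : μ.real Mᶜ ≤ 1 := measureReal_le_one
  nlinarith [hx, hz, L3, hle1, hδ0, measureReal_nonneg (μ := μ) (s := Mᶜ)]

/-- **The glued-set comparison for two relays.**  For every finite weighted graph, vertices `x, z, b` with
`μ(z ↔ b) ≤ μ(x ↔ b)` and every vertex set `N`:
`μ(({z↔b} ∪ ({z↔N} ∩ {N↔b})) ∩ ({N↔x} ∪ {N↔z})) ≤ μ({N↔b} ∩ ({N↔x} ∪ {N↔z}))` — (41) at the glued vertex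
`[N]` of `G/N` with relays `{x, z}`, for the relay `z` designated in `G`.  [cite: KozmaNitzan2024, Question 9
(p. 36), Lemma 3(i) (pp. 6–7)] [cite: VandenbergHaggstromKahn2005, Thm. 1.5 (pp. 7–8)] -/
theorem glued_pair_le (w : Sym2 V → unitInterval) (x z b : V) (N : Set V)
    (h : (prodBernoulli w).real (openConn z b) ≤ (prodBernoulli w).real (openConn x b)) :
    (prodBernoulli w).real
        (((openConn z b : Set (BondConfig V)) ∪
            ({ω | ∃ u ∈ N, (openGraph ω).Reachable z u} ∩ {ω | ∃ u ∈ N, (openGraph ω).Reachable u b})) ∩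
          ({ω | ∃ u ∈ N, (openGraph ω).Reachable u x} ∪ {ω | ∃ u ∈ N, (openGraph ω).Reachable u z})) ≤
      (prodBernoulli w).real
        ({ω : BondConfig V | ∃ u ∈ N, (openGraph ω).Reachable u b} ∩
          ({ω | ∃ u ∈ N, (openGraph ω).Reachable u x} ∪ {ω | ∃ u ∈ N, (openGraph ω).Reachable u z})) := by
  set μ := prodBernoulli w with hμ
  set Nx : Set (BondConfig V) := {ω | ∃ u ∈ N, (openGraph ω).Reachable u x} with hNx
  set Nz : Set (BondConfig V) := {ω | ∃ u ∈ N, (openGraph ω).Reachable u z} with hNz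
  set Nb : Set (BondConfig V) := {ω | ∃ u ∈ N, (openGraph ω).Reachable u b} with hNb
  set zN : Set (BondConfig V) := {ω | ∃ u ∈ N, (openGraph ω).Reachable z u} with hzN
  set M : Set (BondConfig V) := {ω | ∀ u ∈ N, ¬ (openGraph ω).Reachable z u} with hM
  set L : Set (BondConfig V) := ((openConn z b : Set (BondConfig V)) ∪ (zN ∩ Nb)) ∩ (Nx ∪ Nz) with hL
  set R : Set (BondConfig V) := Nb ∩ (Nx ∪ Nz) with hR
  have hMc : ∀ ω, ω ∈ Mᶜ ↔ ∃ u ∈ N, (openGraph ω).Reachable z u := by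
    intro ω
    simp only [hM, mem_compl_iff, mem_setOf_eq, not_forall, not_not, exists_prop]
  -- on `{z ↔ N}` the left event is contained in the right one
  have h1 : L ∩ Mᶜ ⊆ R ∩ Mᶜ := by
    rintro ω ⟨⟨hzb, hU⟩, hMω⟩
    obtain ⟨u, huN, hzu⟩ := (hMc ω).1 hMω
    refine ⟨⟨?_, hU⟩, hMω⟩
    rcases hzb with hzb | ⟨-, hnb⟩
    · exact ⟨u, huN, hzu.symm.trans hzb⟩
    · exact hnb
  -- on `{z ↮ N}` the left event is `{z ↔ b} ∩ {N ↔ x}`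
  have h2 : L ∩ M ⊆ M ∩ openConn z b ∩ Nx := by
    rintro ω ⟨⟨hzb, hU⟩, hMω⟩
    have hzb' : ω ∈ (openConn z b : Set (BondConfig V)) := by
      rcases hzb with hzb | ⟨⟨u, huN, hzu⟩, -⟩
      · exact hzb
      · exact absurd hzu (hMω u huN)
    refine ⟨⟨hMω, hzb'⟩, ?_⟩
    rcases hU with hU | ⟨u, huN, huz⟩
    · exact hU
    · exact absurd huz.symm (hMω u huN)
  -- `{z ↮ N} ∩ {x ↔ b} ∩ {N ↔ x} ⊆ R ∩ {z ↮ N}`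
  have h3 : M ∩ openConn x b ∩ Nx ⊆ R ∩ M := by
    rintro ω ⟨⟨hMω, hxb⟩, ⟨u, huN, hux⟩⟩
    exact ⟨⟨⟨u, huN, hux.trans hxb⟩, Or.inl ⟨u, huN, hux⟩⟩, hMω⟩
  have hsplit : ∀ A : Set (BondConfig V), μ.real A = μ.real (A ∩ M) + μ.real (A ∩ Mᶜ) := by
    intro A
    rw [← measureReal_inter_add_sdiff (s := A) (MeasurableSet.of_discrete : MeasurableSet M), Set.sdiff_eq]
  -- the restricted comparison on `{z ↮ N}`
  have key : μ.real (L ∩ M) ≤ μ.real (R ∩ M) := by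
    by_cases hzmem : z ∈ N
    · have hLM : L ∩ M = ∅ := by
        refine Set.eq_empty_iff_forall_notMem.2 fun ω hω => ?_
        exact (hω.2 z hzmem) (SimpleGraph.Reachable.refl z)
      rw [hLM, measureReal_empty]
      exact measureReal_nonneg
    by_cases hzx : z = x
    · have hLM : L ∩ M = ∅ := by
        refine Set.eq_empty_iff_forall_notMem.2 fun ω hω => ?_
        obtain ⟨⟨-, -⟩, ⟨u, huN, hux⟩⟩ := h2 hω
        exact (hω.2 u huN) (hzx ▸ hux.symm)
      rw [hLM, measureReal_empty]
      exact measureReal_nonneg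
    have step1 := restricted_le_of_le w x z b N h
    have step2 := knLemma3i_restricted w z x b N hzmem hzx Nx 0
      (fun ω ω' hω hsub => setConn_mono_openEdgeCluster N x ω ω' hω hsub) le_rfl
      (by rw [add_zero]; exact step1)
    rw [add_zero] at step2
    calc μ.real (L ∩ M) ≤ μ.real (M ∩ openConn z b ∩ Nx) := measureReal_mono h2
      _ ≤ μ.real (M ∩ openConn x b ∩ Nx) := step2
      _ ≤ μ.real (R ∩ M) := measureReal_mono h3
  calc μ.real L = μ.real (L ∩ M) + μ.real (L ∩ Mᶜ) := hsplit L
    _ ≤ μ.real (R ∩ M) + μ.real (R ∩ Mᶜ) := add_le_add key (measureReal_mono h1)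
    _ = μ.real R := (hsplit R).symm

/-! ### The star decomposition at the observer -/

/-- **One star.**  Let `0 ∉ A`, `z, b ≠ 0`, `B ∌ 0`, `σ_B` the event that the open pairs at `0` are exactly those
to `B`, and `H = restrW {0}ᶜ w` (the pairs at `0` removed).  If in `H`
`μ_H(({z↔b} ∪ ({z↔B} ∩ {B↔b})) ∩ {B↔A}) ≤ μ_H({B↔b} ∩ {B↔A})`, then
`μ({z↔b} ∩ {0↔A} ∩ σ_B) ≤ μ({0↔b} ∩ {0↔A} ∩ σ_B)`: under `σ_B` an open path through `0` enters and leaves through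
`B`, and `σ_B` is independent of the pairs off `0`. [cite: KozmaNitzan2024, Lemma 5 and proof of Thm. 4 (pp. 13–14)] -/
theorem star_le (w : Sym2 V → unitInterval) (A : Finset V) (o b z : V) (hzo : z ≠ o) (hbo : b ≠ o)
    (ho : o ∉ A) (B : Finset V) (hoB : o ∉ B)
    (hB : (prodBernoulli (restrW ({o}ᶜ : Set V) w)).real
        (((openConn z b : Set (BondConfig V)) ∪
            ({ω | ∃ u ∈ B, (openGraph ω).Reachable z u} ∩ {ω | ∃ u ∈ B, (openGraph ω).Reachable u b})) ∩
          {ω | ∃ a ∈ A, ∃ u ∈ B, (openGraph ω).Reachable u a}) ≤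
      (prodBernoulli (restrW ({o}ᶜ : Set V) w)).real
        ({ω : BondConfig V | ∃ u ∈ B, (openGraph ω).Reachable u b} ∩
          {ω | ∃ a ∈ A, ∃ u ∈ B, (openGraph ω).Reachable u a})) :
    (prodBernoulli w).real (openConn z b ∩ (⋃ a ∈ A, openConn o a) ∩ starEvent o ↑B) ≤
      (prodBernoulli w).real (openConn o b ∩ (⋃ a ∈ A, openConn o a) ∩ starEvent o ↑B) := by
  set μ := prodBernoulli w with hμ
  set S : Set V := {o}ᶜ with hS
  set U : Set (BondConfig V) := ⋃ a ∈ A, openConn o a with hU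
  set E1 : Set (BondConfig V) := ((openConn z b : Set (BondConfig V)) ∪
      ({ω | ∃ u ∈ B, (openGraph ω).Reachable z u} ∩ {ω | ∃ u ∈ B, (openGraph ω).Reachable u b})) ∩
    {ω | ∃ a ∈ A, ∃ u ∈ B, (openGraph ω).Reachable u a} with hE1
  set E2 : Set (BondConfig V) := {ω : BondConfig V | ∃ u ∈ B, (openGraph ω).Reachable u b} ∩
    {ω | ∃ a ∈ A, ∃ u ∈ B, (openGraph ω).Reachable u a} with hE2
  -- the events `E1, E2` read on the configuration cut down to the pairs off `0`
  set D1 : Set (BondConfig V) := {ω | ω ∩ wireSet S ∈ E1} with hD1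
  set D2 : Set (BondConfig V) := {ω | ω ∩ wireSet S ∈ E2} with hD2
  have hdet : ∀ E : Set (BondConfig V), DeterminedBy {ω : BondConfig V | ω ∩ wireSet S ∈ E} (wireSet S) := by
    intro E
    rw [determinedBy_iff]
    intro ω ω' hωω'
    simp only [mem_setOf_eq]
    rw [hωω']
  have hbr1 : (prodBernoulli (restrW S w)).real E1 = μ.real D1 := KNGoodAux.restrW_real_eq w S E1
  have hbr2 : (prodBernoulli (restrW S w)).real E2 = μ.real D2 := KNGoodAux.restrW_real_eq w S E2
  have hzS : z ∈ S := mem_compl_singleton_iff.2 hzo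
  have hmemS : ∀ u ∈ B, u ∈ S := fun u hu => mem_compl_singleton_iff.2 fun h => hoB (h ▸ hu)
  -- reachability of the cut configuration = reachability off `0`
  have hcut : ∀ (ω : BondConfig V) {p : V} (hp : p ∈ S) (q : V),
      (openGraph (ω ∩ wireSet S)).Reachable p q ↔ ω ∈ openConnIn S p q := fun ω p hp q =>
    KNGoodAux.inter_wireSet_mem_openConn_iff hp q
  -- `{z ↔ b} ∩ {0 ↔ A} ∩ σ_B ⊆ σ_B ∩ D1`
  have hsub1 : (openConn z b : Set (BondConfig V)) ∩ U ∩ starEvent o ↑B ⊆ starEvent o ↑B ∩ D1 := by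
    rintro ω ⟨⟨hzb, hωU⟩, hσ⟩
    refine ⟨hσ, ?_⟩
    simp only [hD1, hE1, mem_setOf_eq, mem_inter_iff, mem_union]
    constructor
    · obtain ⟨p⟩ := (hzb : (openGraph ω).Reachable z b)
      rcases (KNPreFKG.walk_decomp hσ p hbo).1 hzo with h | ⟨⟨u, huB, huo, hzu⟩, ⟨u', hu'B, hu'o, hu'b⟩⟩
      · exact Or.inl ((hcut ω hzS b).2 h)
      · refine Or.inr ⟨⟨u, huB, (hcut ω hzS u).2 hzu⟩, ⟨u', hu'B, ?_⟩⟩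
        exact (hcut ω (mem_compl_singleton_iff.2 hu'o) b).2 hu'b
    · obtain ⟨a, haA, hoa⟩ : ∃ a ∈ A, ω ∈ (openConn o a : Set (BondConfig V)) := by
        simpa only [hU, mem_iUnion, exists_prop] using hωU
      have hao : a ≠ o := fun h => ho (h ▸ haA)
      obtain ⟨p⟩ := (hoa : (openGraph ω).Reachable o a)
      obtain ⟨u', hu'B, hu'o, hu'a⟩ := (KNPreFKG.walk_decomp hσ p hao).2 rfl
      exact ⟨a, haA, u', hu'B, (hcut ω (mem_compl_singleton_iff.2 hu'o) a).2 hu'a⟩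
  -- `σ_B ∩ D2 ⊆ {0 ↔ b} ∩ {0 ↔ A} ∩ σ_B`
  have hreach : ∀ (ω : BondConfig V), ω ∈ starEvent o (↑B : Set V) → ∀ u ∈ B, ∀ q : V,
      (openGraph (ω ∩ wireSet S)).Reachable u q → (openGraph ω).Reachable o q := by
    intro ω hσ u huB q huq
    have huo : u ≠ o := fun h => hoB (h ▸ huB)
    have huq' : (openGraph ω).Reachable u q := KNPreFKG.reachable_of_openConnIn ((hcut ω (hmemS u huB) q).1 huq)
    have hou : s(o, u) ∈ ω := ((mem_starEvent_iff o (↑B) ω).1 hσ u huo).2 huB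
    have hadj : (openGraph ω).Adj o u := (openGraph_adj ω o u).2 ⟨hou, huo.symm⟩
    exact hadj.reachable.trans huq'
  have hsub2 : starEvent o ↑B ∩ D2 ⊆ (openConn o b : Set (BondConfig V)) ∩ U ∩ starEvent o ↑B := by
    rintro ω ⟨hσ, hω⟩
    simp only [hD2, hE2, mem_setOf_eq, mem_inter_iff] at hω
    obtain ⟨⟨u, huB, hub⟩, ⟨a, haA, u', hu'B, hu'a⟩⟩ := hω
    refine ⟨⟨hreach ω hσ u huB b hub, ?_⟩, hσ⟩
    simp only [hU, mem_iUnion, exists_prop]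
    exact ⟨a, haA, hreach ω hσ u' hu'B a hu'a⟩
  have hB' : μ.real D1 ≤ μ.real D2 := by rw [← hbr1, ← hbr2]; exact hB
  calc μ.real (openConn z b ∩ U ∩ starEvent o ↑B)
      ≤ μ.real (starEvent o ↑B ∩ D1) := measureReal_mono hsub1
    _ = μ.real (starEvent o ↑B) * μ.real D1 := KNGoodAux.real_starEvent_inter_of_determinedBy w o ↑B (hdet E1)
    _ ≤ μ.real (starEvent o ↑B) * μ.real D2 := mul_le_mul_of_nonneg_left hB' measureReal_nonneg
    _ = μ.real (starEvent o ↑B ∩ D2) := (KNGoodAux.real_starEvent_inter_of_determinedBy w o ↑B (hdet E2)).symm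
    _ ≤ μ.real (openConn o b ∩ U ∩ starEvent o ↑B) := measureReal_mono hsub2

/-- **The star decomposition of (41).**  Let `0 ∉ A`, `z, b ≠ 0`, `H = restrW {0}ᶜ w`.  If for every vertex set
`B ∌ 0` the glued-set inequality `μ_H(({z↔b} ∪ ({z↔B} ∩ {B↔b})) ∩ {B↔A}) ≤ μ_H({B↔b} ∩ {B↔A})` holds, then the
pre-FKG inequality (41) holds at `0` for the relay `z`: `μ({z↔b} ∩ {0↔A}) ≤ μ({0↔b} ∩ {0↔A})` — sum the stars
(`KNPreFKG.real_eq_sum_inter_starEvent`; every vertex `≠ 0` may be a neighbour of `0`).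
[cite: KozmaNitzan2024, Lemma 5 and proof of Thm. 4 (pp. 13–14), Question 9 (p. 36)] -/
theorem block41_of_stars (w : Sym2 V → unitInterval) (A : Finset V) (o b z : V) (hzo : z ≠ o) (hbo : b ≠ o)
    (ho : o ∉ A)
    (hstar : ∀ B : Finset V, o ∉ B →
      (prodBernoulli (restrW ({o}ᶜ : Set V) w)).real
          (((openConn z b : Set (BondConfig V)) ∪
              ({ω | ∃ u ∈ B, (openGraph ω).Reachable z u} ∩ {ω | ∃ u ∈ B, (openGraph ω).Reachable u b})) ∩
            {ω | ∃ a ∈ A, ∃ u ∈ B, (openGraph ω).Reachable u a}) ≤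
        (prodBernoulli (restrW ({o}ᶜ : Set V) w)).real
          ({ω : BondConfig V | ∃ u ∈ B, (openGraph ω).Reachable u b} ∩
            {ω | ∃ a ∈ A, ∃ u ∈ B, (openGraph ω).Reachable u a})) :
    (prodBernoulli w).real (openConn z b ∩ ⋃ a ∈ A, openConn o a) ≤
      (prodBernoulli w).real (openConn o b ∩ ⋃ a ∈ A, openConn o a) := by
  have ho' : o ∉ Finset.univ.erase o := fun h => (Finset.mem_erase.1 h).1 rfl
  have hiso : ∀ u, u ≠ o → u ∉ Finset.univ.erase o → w s(o, u) = 0 :=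
    fun u huo hu => absurd (Finset.mem_erase.2 ⟨huo, Finset.mem_univ u⟩) hu
  rw [KNPreFKG.real_eq_sum_inter_starEvent w (Finset.univ.erase o) o ho' hiso (openConn z b ∩ ⋃ a ∈ A, openConn o a),
    KNPreFKG.real_eq_sum_inter_starEvent w (Finset.univ.erase o) o ho' hiso (openConn o b ∩ ⋃ a ∈ A, openConn o a)]
  refine Finset.sum_le_sum fun B hB => ?_
  have hoB : o ∉ B := fun h => ho' (Finset.mem_powerset.1 hB h)
  exact star_le w A o b z hzo hbo ho B hoB (hstar B hoB)

/-! ### Question 9 for two relays -/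

/-- **KOZMA–NITZAN'S QUESTION 9 HOLDS FOR TWO RELAYS.**  On every finite weighted graph: for `0`, `b` and relays
`x, z ≠ 0` with `μ_H(z ↔ b) ≤ μ_H(x ↔ b)`, where `H = restrW {0}ᶜ w` is the graph with the pairs at `0` removed,
the pre-FKG inequality (41) holds for `z`:  `μ({z↔b} ∩ {0↔{x,z}}) ≤ μ({0↔b} ∩ {0↔{x,z}})`.
(Star decomposition `block41_of_stars` + the glued-set comparison `glued_pair_le` in `H`.)
[cite: KozmaNitzan2024, Question 9 (§5.5 p. 36)] -/
theorem knQuestion9_two (w : Sym2 V → unitInterval) (o b x z : V) (hxo : x ≠ o) (hzo : z ≠ o)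
    (hmin : (prodBernoulli (restrW ({o}ᶜ : Set V) w)).real (openConn z b) ≤
      (prodBernoulli (restrW ({o}ᶜ : Set V) w)).real (openConn x b)) :
    (prodBernoulli w).real (openConn z b ∩ ⋃ a ∈ ({x, z} : Finset V), openConn o a) ≤
      (prodBernoulli w).real (openConn o b ∩ ⋃ a ∈ ({x, z} : Finset V), openConn o a) := by
  by_cases hbo : b = o
  · subst hbo
    exact measureReal_mono fun ω hω => ⟨SimpleGraph.Reachable.refl _, hω.2⟩
  have ho : o ∉ ({x, z} : Finset V) := by
    simp only [Finset.mem_insert, Finset.mem_singleton, not_or]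
    exact ⟨fun h => hxo h.symm, fun h => hzo h.symm⟩
  refine block41_of_stars w {x, z} o b z hzo hbo ho fun B _ => ?_
  have hA : {ω : BondConfig V | ∃ a ∈ ({x, z} : Finset V), ∃ u ∈ B, (openGraph ω).Reachable u a} =
      {ω | ∃ u ∈ (↑B : Set V), (openGraph ω).Reachable u x} ∪ {ω | ∃ u ∈ (↑B : Set V), (openGraph ω).Reachable u z} := by
    ext ω
    simp only [Finset.mem_insert, Finset.mem_singleton, mem_setOf_eq, mem_union, Finset.mem_coe]
    constructor
    · rintro ⟨a, rfl | rfl, u, huB, hua⟩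
      · exact Or.inl ⟨u, huB, hua⟩
      · exact Or.inr ⟨u, huB, hua⟩
    · rintro (⟨u, huB, hux⟩ | ⟨u, huB, huz⟩)
      · exact ⟨x, Or.inl rfl, u, huB, hux⟩
      · exact ⟨z, Or.inr rfl, u, huB, huz⟩
  have key := glued_pair_le (restrW ({o}ᶜ : Set V) w) x z b ↑B hmin
  simp only [Finset.mem_coe] at key
  rw [hA]
  simpa only [Finset.mem_coe] using key

/-- **Question 9 for every relay set with at most two relays**, in the shape of the hypothesis of
`SoloBlindKN.knQuestion7_of_question9`: `0 ∉ A`, `|A| ≤ 2`, `a ∈ A` minimising `μ_H(· ↔ b)` over `A`,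
`H = restrW {0}ᶜ w` ⟹ `μ({a↔b} ∩ {0↔A}) ≤ μ({0↔b} ∩ {0↔A})`. [cite: KozmaNitzan2024, Question 9 (§5.5 p. 36)] -/
theorem knQuestion9_of_card_le_two (w : Sym2 V → unitInterval) (A : Finset V) (o b a : V) (hA : A.card ≤ 2)
    (ho : o ∉ A) (ha : a ∈ A)
    (hmin : ∀ a' ∈ A, (prodBernoulli (restrW ({o}ᶜ : Set V) w)).real (openConn a b) ≤
      (prodBernoulli (restrW ({o}ᶜ : Set V) w)).real (openConn a' b)) :
    (prodBernoulli w).real (openConn a b ∩ ⋃ a' ∈ A, openConn o a') ≤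
      (prodBernoulli w).real (openConn o b ∩ ⋃ a' ∈ A, openConn o a') := by
  -- `A = {x, a}` for some `x ∈ A` (possibly `x = a`)
  obtain ⟨x, hxA, hAeq⟩ : ∃ x ∈ A, A = {x, a} := by
    by_cases h1 : A.erase a = ∅
    · refine ⟨a, ha, ?_⟩
      ext y
      simp only [Finset.mem_insert, Finset.mem_singleton, or_self]
      constructor
      · intro hy
        by_contra hne
        have : y ∈ A.erase a := Finset.mem_erase.2 ⟨hne, hy⟩
        rw [h1] at this
        exact absurd this (Finset.notMem_empty y)
      · rintro rfl; exact ha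
    · obtain ⟨x, hx⟩ := Finset.nonempty_iff_ne_empty.2 h1
      have hxA : x ∈ A := Finset.mem_of_mem_erase hx
      have hxa : x ≠ a := (Finset.mem_erase.1 hx).1
      refine ⟨x, hxA, ?_⟩
      symm
      apply Finset.eq_of_subset_of_card_le
      · intro y hy
        rcases Finset.mem_insert.1 hy with rfl | hy
        · exact hxA
        · rw [Finset.mem_singleton.1 hy]; exact ha
      · rw [Finset.card_pair hxa]
        exact hA
  have hxo : x ≠ o := fun h => ho (h ▸ hxA)
  have hao : a ≠ o := fun h => ho (h ▸ ha)
  rw [hAeq]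
  exact knQuestion9_two w o b x a hxo hao (hmin x hxA)

end KnQ9

end Summit.CriticalPhenomena.PercolationContinuityZ3.Theorems
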